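import Literature.AlgebraicGeometry.HodgeTheory.CyclicCoverDeckIsMonodromy
import Literature.AlgebraicGeometry.HodgeTheory.CyclicCoverBaseChart
import Mathlib.AlgebraicTopology.FundamentalGroupoid.InducedMaps
import HarnessLib

/-!
# The monodromy of the universal family of cyclic covers COMMUTES with the covering transformation
# (Carlson–Toledo 1999 §2: "automorphisms […] which commute with the cyclic group of covering transformations")

Family `hodge`, layer `Literature/AlgebraicGeometry/HodgeTheory`; theorems only (no definition, no named fact).
Sequel of `CyclicCoverDeckIsMonodromy` (prover-Ax g7: the covering transformation `τ` of `H²(𝒴_{[F]}; ℚ)` is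
itself a monodromy transformation — `τ⁻¹` is the rational transport along the Carlson–Toledo scaling loop
`ctLoop : u ↦ [x₃^p − e^{2πiu} f]`).

**Main theorem** (`ratTransport_comm_deck`): for every loop `γ` at `[F]` in the base `S(ℂ)` of the universal
family of `p`-cyclic covers of the plane, the rational transport `T` of `R² u_* ℚ` along `γ` commutes with the
covering automorphism `τ` (matched with the deck transformation `σ_F^*` by an embedding-compatible
identification `e : 𝒴_{[F]} ≅ X_F`). This is the (elementary) fact behind Carlson–Toledo's standing convention
that the monodromy group lies in the centraliser of the cyclic covering group (§2, §4), used by the route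
`Summits/HodgeConjecture/HodgeConjecture/Theses/CyclicUnitaryPowers.lean` (crux K1) to recognise the local
monodromy of a meridian as a power of `τ` on its vanishing space (`CyclicReflectionRecognition`).

**Proof.** The class of the scaling loop is CENTRAL in `π₁(S(ℂ), [F])`: the scaling action of the unit
circle on branch forms, read in the coefficient chart `χ : S(ℂ) ≃ₜ {D ≠ 0} ⊂ ℂ^{N}` (`CyclicCoverBaseChart`;
scaling a branch form keeps its cyclic cover smooth, `isNonsingularForm_cyclicCoverForm_smul`), is a homotopy
from the identity of `S(ℂ)` to itself whose track at `[F]` is `ctLoop`; for a homotopy `F : id ≃ id` and any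
path `γ`, `γ · F(–, γ(1)) ≃ F(–, γ(0)) · γ` (Mathlib's `Path.Homotopic.map_trans_evalAt`). Hence the transports
along `γ · ctLoop` and `ctLoop · γ` — `T` then `τ⁻¹`, resp. `τ⁻¹` then `T` — coincide (uniqueness of rational
transport), i.e. `T τ = τ T`.

* `cyclicCoverForm_injective`, `branchForm_cyclicCoverPoint`, `chart_cyclicCoverPoint` — the coefficient chart
  reads the coefficients of a classified form;
* `smul_mem_affineHypersurfaceComplement` — `{D ≠ 0}` is stable under non-zero scalars;
* **`ratTransport_comm_deck`**.

Written by the prover seat `hodge-nonav-prover-Ax` (g9).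

## References

* [CarlsonToledo1999] J. A. Carlson, D. Toledo, Discriminant complements and kernels of monodromy
  representations, Duke Math. J. 97 (1999); arXiv alg-geom/9708002, §2 (universalcyclic) (held text
  p0004–p0005): the cyclic group of covering transformations acts on the universal family; the monodromy
  representation takes values in the automorphisms commuting with it.
* [VoisinHodgeII2003] C. Voisin, Hodge Theory and Complex Algebraic Geometry II, CUP 2003, §3.1.2 (local systems
  and monodromy).
-/

noncomputable section

namespace Literature.AlgebraicGeometry.HodgeTheory

open CategoryTheory MvPolynomial
open _root_.Topology
open scoped unitInterval
open Literature.AlgebraicGeometry.Motives Literature.AlgebraicGeometry.Motives.UniversalHypersurface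
open Literature.AlgebraicGeometry.HodgeTheory.UniversalHypersurface
open Literature.AlgebraicTopology.SingularHomology
open Literature.AlgebraicGeometry.FundamentalGroup

namespace CyclicCoverScaling

section Commute

variable {p : ℕ} {f : MvPolynomial (Fin 3) ℂ}

/-- `f ↦ x₃^p − f` is injective. [cite: CarlsonToledo1999, §2 (held text p0004)] -/
theorem cyclicCoverForm_injective : Function.Injective (cyclicCoverForm p) := by
  intro a b h
  rw [cyclicCoverForm_def, cyclicCoverForm_def, sub_right_inj] at h
  exact MvPolynomial.rename_injective _ (Fin.castSucc_injective _) h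

/-- **`{D ≠ 0}` is stable under non-zero scalars**: scaling a branch form by `c ≠ 0` keeps its cyclic cover
form nonsingular (`isNonsingularForm_cyclicCoverForm_smul`). [cite: CarlsonToledo1999, §2 (held text p0004)] -/
theorem smul_mem_affineHypersurfaceComplement (hp : 2 ≤ p) {D : MvPolynomial (TernaryIndex p) ℂ}
    (hDeq : IsDiscriminantEquation p D) {c : ℂ} (hc : c ≠ 0) {b : TernaryIndex p → ℂ}
    (hb : b ∈ affineHypersurfaceComplement ![D]) : c • b ∈ affineHypersurfaceComplement ![D] := by
  rw [mem_affineHypersurfaceComplement_iff] at hb ⊢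
  intro j
  obtain rfl : j = 0 := Subsingleton.elim _ _
  have hb0 := hb 0
  simp only [Matrix.cons_val_zero] at hb0 ⊢
  intro h0
  have hg : (∑ e : TernaryIndex p, monomial e.1 (b e)).IsHomogeneous p :=
    IsHomogeneous.sum _ _ _ fun e _ => isHomogeneous_monomial _ e.2
  have hns : SmoothHypersurface.IsNonsingularForm ℂ
      (cyclicCoverForm p (∑ e : TernaryIndex p, monomial e.1 (b e))) := by
    by_contra hs
    exact hb0 ((hDeq b).mpr hs)
  have hsum : (∑ e : TernaryIndex p, monomial e.1 ((c • b) e)) =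
      c • ∑ e : TernaryIndex p, monomial e.1 (b e) := by
    rw [Finset.smul_sum]
    refine Finset.sum_congr rfl fun e _ => ?_
    rw [Pi.smul_apply, smul_eq_mul, smul_monomial, smul_eq_mul]
  refine (hDeq (c • b)).mp h0 ?_
  rw [hsum]
  exact isNonsingularForm_cyclicCoverForm_smul hp hg hc hns

variable [NeZero p]

/-- **The branch form of the classifying point `[x₃^p − g]` is `g`** (for `g` a ternary `p`-form with
nonsingular cyclic cover form). [cite: CarlsonToledo1999, §2 (held text p0004)] -/
theorem branchForm_cyclicCoverPoint {g : MvPolynomial (Fin 3) ℂ} (hg : g.IsHomogeneous p)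
    (hJ : SmoothHypersurface.IsNonsingularForm ℂ (cyclicCoverForm p g)) :
    branchForm p (cyclicCoverPoint p g) = g := by
  refine cyclicCoverForm_injective (p := p) ?_
  rw [cyclicCoverForm_branchForm, cyclicCoverPoint_eq p hg hJ]
  exact pointFormSpz_pointOfFormSpz ℂ 2 p _ _ hJ _

/-- **A coefficient chart reads the coefficients of a classified form**: `χ([x₃^p − g])_e = coeff_e g`.
[cite: CarlsonToledo1999, §2 (held text p0004)] -/
theorem chart_cyclicCoverPoint {D : MvPolynomial (TernaryIndex p) ℂ}
    {χ : ComplexPoints (cyclicCoverBase p) ≃ₜ affineHypersurfaceComplement ![D]} (hχ : IsCoefficientChart p D χ)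
    {g : MvPolynomial (Fin 3) ℂ} (hg : g.IsHomogeneous p)
    (hJ : SmoothHypersurface.IsNonsingularForm ℂ (cyclicCoverForm p g)) (e : TernaryIndex p) :
    (χ (cyclicCoverPoint p g) : TernaryIndex p → ℂ) e = g.coeff e.1 := by
  rw [hχ, branchForm_cyclicCoverPoint hg hJ]

/-- **The monodromy commutes with the covering transformation.** For a non-zero ternary `p`-form `f`
(`p ≥ 2`) with smooth cyclic cover `X_F`, an embedding-compatible identification `e : 𝒴_{[F]} ≅ X_F`, the
covering automorphism `τ` of `H²(𝒴_{[F]}(ℂ); ℚ)` matched with `σ_F^*` by `e`, and ANY loop `γ` at `[F]` in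
`S(ℂ)`: the rational transport `T` of `R² u_* ℚ` along `γ` satisfies `T τ = τ T`. (The scaling loop, whose
transport is `τ⁻¹`, is central in `π₁(S(ℂ), [F])`: the circle action on branch forms is a homotopy `id ≃ id` of
the base.) [cite: CarlsonToledo1999, §2 (universalcyclic) (held text p0004–p0005)] [cite: VoisinHodgeII2003, §3.1.2] -/
theorem ratTransport_comm_deck (hp : 2 ≤ p) (hf : f.IsHomogeneous p) (hf0 : f ≠ 0)
    (hX : IsSmoothProjective 2 (SmoothHypersurface.hypersurface (cyclicCoverForm p f)))
    (e : fiberOver (cyclicCoverFamily p) (cyclicCoverPoint p f) ≅ SmoothHypersurface.hypersurface (cyclicCoverForm p f))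
    (he : IsCompatibleFibreIso p e)
    (τ : bettiCohomology (fiberOver (cyclicCoverFamily p) (cyclicCoverPoint p f)) 2 ≃ₗ[ℚ]
      bettiCohomology (fiberOver (cyclicCoverFamily p) (cyclicCoverPoint p f)) 2)
    (hτ : ∀ (ha : deckUnit p ∈ diagonalStabilizer (cyclicCoverForm p f))
      (x : bettiCohomology (fiberOver (cyclicCoverFamily p) (cyclicCoverPoint p f)) 2),
      BettiUniverse.pullEquiv e 2 (τ x) =
        BettiUniverse.pull (diagonalAut (cyclicCoverForm p f) ha) 2 (BettiUniverse.pullEquiv e 2 x))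
    (γ : Path (cyclicCoverPoint p f) (cyclicCoverPoint p f))
    {T : bettiCohomology (fiberOver (cyclicCoverFamily p) (cyclicCoverPoint p f)) 2 ≃ₗ[ℚ]
      bettiCohomology (fiberOver (cyclicCoverFamily p) (cyclicCoverPoint p f)) 2}
    (hT : IsRatTransport (cyclicCoverFamily p) 2 (cyclicCoverFamily_locallyTrivial p) (cyclicCoverLoopClass p γ) T) :
    T * τ = τ * T := by
  have hJ := CyclicCoverFormNonsingular.isNonsingularForm_cyclicCoverForm_of_isSmoothProjective hp hf hf0 hX
  -- (1) `τ⁻¹` is the rational transport along the Carlson–Toledo scaling loop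
  have hTct := isRatTransport_ctLoop hp hf hf0 hJ e he
  have ha := deckUnit_mem_diagonalStabilizer (NeZero.ne p) f
  have pull_pull : ∀ {X Y Z : SchemeOver ℂ} (g : X ⟶ Y) (h : Y ⟶ Z) (k : ℕ) (x : bettiCohomology Z k),
      BettiUniverse.pull g k (BettiUniverse.pull h k x) = BettiUniverse.pull (g ≫ h) k x := by
    intro X Y Z g h k x
    rw [BettiUniverse.pull_comp]
    rfl
  have hτT : τ * (BettiUniverse.pullEquiv e 2 ≪≫ₗ deckInvPull p f 2 ≪≫ₗ (BettiUniverse.pullEquiv e 2).symm) = 1 := by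
    refine LinearEquiv.ext fun x => ?_
    change τ ((BettiUniverse.pullEquiv e 2 ≪≫ₗ deckInvPull p f 2 ≪≫ₗ (BettiUniverse.pullEquiv e 2).symm) x) = x
    apply (BettiUniverse.pullEquiv e 2).injective
    rw [hτ ha, LinearEquiv.trans_apply, LinearEquiv.trans_apply, LinearEquiv.apply_symm_apply, deckInvPull_apply,
      pull_pull, diagonalAut_comp_inv_over ha, BettiUniverse.pull_id, LinearMap.id_apply]
  have hinv : τ⁻¹ = BettiUniverse.pullEquiv e 2 ≪≫ₗ deckInvPull p f 2 ≪≫ₗ (BettiUniverse.pullEquiv e 2).symm :=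
    (eq_inv_of_mul_eq_one_right hτT).symm
  have hTinv : IsRatTransport (cyclicCoverFamily p) 2 (cyclicCoverFamily_locallyTrivial p) ⟦ctLoop hp hf hJ⟧ τ⁻¹ := by
    rw [hinv]
    exact hTct
  -- (2) a coefficient chart of the base
  obtain ⟨D, -, hDeq⟩ := exists_irreducible_discriminantEquation p hp
  obtain ⟨χ, hχ⟩ := exists_homeomorph_affineHypersurfaceComplement p hDeq
  -- (3) the full turn `u ↦ e^{2πiu}` in the parametrisation of `ctLoop` (two half-turns)
  set c : Path (1 : ℂ) 1 :=
    (({ toFun := halfTurn 0, continuous_toFun := continuous_halfTurn 0, source' := rfl, target' := rfl } :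
        Path (halfTurn 0 0) (halfTurn 0 1)).cast halfTurn_zero_zero.symm halfTurn_zero_one.symm).trans
      (({ toFun := halfTurn 1, continuous_toFun := continuous_halfTurn 1, source' := rfl, target' := rfl } :
        Path (halfTurn 1 0) (halfTurn 1 1)).cast rfl halfTurn_one_one.symm) with hc
  have hc0 : ∀ u, c u ≠ 0 := fun u => by
    rw [hc, Path.trans_apply]
    split_ifs <;> exact halfTurn_ne_zero _ _
  have hct : ∀ u, ((ctLoop hp hf hJ u : (Set.univ : Set (ComplexPoints (cyclicCoverBase p)))) :
      ComplexPoints (cyclicCoverBase p)) = cyclicCoverPoint p (c u • f) := fun u => by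
    rw [hc, Path.trans_apply]
    simp only [ctLoop, Path.map_coe, Function.comp_apply, id_eq]
    rw [Path.trans_apply]
    split_ifs <;> rfl
  -- (4) the rotation homotopy `id ≃ id` of the base, read in the chart `χ`
  let F : ContinuousMap.Homotopy (ContinuousMap.id (Set.univ : Set (ComplexPoints (cyclicCoverBase p))))
      (ContinuousMap.id (Set.univ : Set (ComplexPoints (cyclicCoverBase p)))) :=
    { toFun := fun ux => ⟨χ.symm ⟨c ux.1 • (χ ux.2.1 : TernaryIndex p → ℂ),
          smul_mem_affineHypersurfaceComplement hp hDeq (hc0 ux.1) (χ ux.2.1).2⟩, Set.mem_univ _⟩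
      continuous_toFun := by
        refine (χ.symm.continuous.comp ?_).subtype_mk _
        exact Continuous.subtype_mk ((c.continuous.comp continuous_fst).smul
          (continuous_subtype_val.comp (χ.continuous.comp (continuous_subtype_val.comp continuous_snd)))) _
      map_zero_left := fun x => by
        apply Subtype.ext
        change χ.symm _ = (x : ComplexPoints (cyclicCoverBase p))
        rw [Homeomorph.symm_apply_eq]
        apply Subtype.ext
        change c 0 • (χ x.1 : TernaryIndex p → ℂ) = χ x.1
        rw [c.source, one_smul]
      map_one_left := fun x => by
        apply Subtype.ext
        change χ.symm _ = (x : ComplexPoints (cyclicCoverBase p))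
        rw [Homeomorph.symm_apply_eq]
        apply Subtype.ext
        change c 1 • (χ x.1 : TernaryIndex p → ℂ) = χ x.1
        rw [c.target, one_smul] }
  -- its track at `[F]` is the Carlson–Toledo loop
  have hF : F.evalAt ⟨cyclicCoverPoint p f, Set.mem_univ _⟩ = ctLoop hp hf hJ := by
    refine Path.ext (funext fun u => Subtype.ext (Eq.trans ?_ (hct u).symm))
    change χ.symm ⟨c u • (χ (cyclicCoverPoint p f) : TernaryIndex p → ℂ), _⟩ = cyclicCoverPoint p (c u • f)
    rw [Homeomorph.symm_apply_eq]
    apply Subtype.ext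
    funext e'
    change c u * (χ (cyclicCoverPoint p f) : TernaryIndex p → ℂ) e' =
      (χ (cyclicCoverPoint p (c u • f)) : TernaryIndex p → ℂ) e'
    rw [chart_cyclicCoverPoint hχ hf hJ, chart_cyclicCoverPoint hχ (isHomogeneous_smul hf (c u))
      (isNonsingularForm_cyclicCoverForm_smul hp hf (hc0 u) hJ), MvPolynomial.coeff_smul, smul_eq_mul]
  -- (5) the scaling loop is central: `γ · ctLoop ≃ ctLoop · γ`
  set γ' : Path (⟨cyclicCoverPoint p f, Set.mem_univ _⟩ : (Set.univ : Set (ComplexPoints (cyclicCoverBase p))))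
      ⟨cyclicCoverPoint p f, Set.mem_univ _⟩ := γ.map (continuous_id.subtype_mk fun x => Set.mem_univ x) with hγ'
  have hcomm : (γ'.trans (ctLoop hp hf hJ)).Homotopic ((ctLoop hp hf hJ).trans γ') := by
    have h := Path.Homotopic.map_trans_evalAt F γ'
    rw [hF] at h
    have hid : γ'.map (map_continuous (ContinuousMap.id _)) = γ' := Path.ext (funext fun _ => rfl)
    rwa [hid] at h
  have hcls : (cyclicCoverLoopClass p γ).trans ⟦ctLoop hp hf hJ⟧ =
      Path.Homotopic.Quotient.trans ⟦ctLoop hp hf hJ⟧ (cyclicCoverLoopClass p γ) :=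
    Quotient.sound hcomm
  -- (6) transports along `γ · ctLoop` and `ctLoop · γ` coincide
  have h1 := hT.trans (cyclicCoverFamily p) 2 (cyclicCoverFamily_locallyTrivial p) hTinv
  have h2 := hTinv.trans (cyclicCoverFamily p) 2 (cyclicCoverFamily_locallyTrivial p) hT
  rw [hcls] at h1
  have heq : T ≪≫ₗ τ⁻¹ = τ⁻¹ ≪≫ₗ T := LinearEquiv.ext fun v => ofRatClass_injective 2 (by rw [h1 v, h2 v])
  have h3 : τ⁻¹ * T = T * τ⁻¹ := by
    rw [LinearEquiv.mul_eq_trans, LinearEquiv.mul_eq_trans, heq]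
  calc T * τ = τ * (τ⁻¹ * T) * τ := by rw [mul_inv_cancel_left]
    _ = τ * (T * τ⁻¹) * τ := by rw [h3]
    _ = τ * T := by rw [← mul_assoc, inv_mul_cancel_right]

end Commute

end CyclicCoverScaling

end Literature.AlgebraicGeometry.HodgeTheory

end
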